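import Mathlib.Analysis.SpecialFunctions.Exp
import Mathlib.Analysis.SpecialFunctions.Pow.Real

/-!
# `ClampedEntropyClock` (stmt-AtomisticToContinuum-15145): the energy-row bookkeeping of Yau's clock — typed quantifier shapes vs. the `∀ β` shape (negative helper file; no Theses declaration is asserted; from `Cruxes/ClampedEntropyClock/Disproof.lean` §7 and the item evidence `GronwallCoreEnergyRow.md`; refuter-cdisprove-stmt-AtomisticToContinuum-15145-0)

The crux `TwoClocks.ClampedEntropyClock` encodes Yau's linear relative-entropy Gronwall fed by finite-window
large-deviation inputs. Each window-averaged current is moved from the reference `ψ_s` to the true law `f_s` by the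
entropy inequality at a rate `β`, which ends up in the Gronwall factor `exp(t Σ 1/β)`. The CUBIC kinetic heat flux
of the energy row must be truncated at a level `M` whose tail is controlled by the antecedent `EnergyCurrentTails`
in the shape `∀ ε ∃ M` (no rate; the fixed-`M` tail does not vanish as `N → ∞`), so `M → ∞` is forced and the
docking node `KineticWindowLDUniform` is applied to the FAMILY of truncations `F_M`; as typed the node yields
`∃ β₀(F_M)` AFTER `∀ F`, with no lower bound in `M`.

This file kernel-checks the resulting quantifier-shape obstruction in a toy where `Λ M β τ N` stands for the
per-particle window log-mgf of `F_M`, `r M` for the cubic tail in mean and `gronwallBound` for what linear Gronwall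
certifies about the specific relative entropy at unit time from `h_0 = 0`:

* `exists_typedShapes_gronwallBound_ge_one` — with the TYPED shapes (`NodeShapeTyped`, `TailShape`) there are
  nonnegative inputs for which no admissible choice of `(M, β, τ, N)` certifies anything below `1`;
* `allBeta_gronwallBound_small` — with the node in the `∀ β` shape for the bounded truncations (`NodeShapeAllBeta`:
  β before ε, τ after β) the certificate is driven below every `η > 0`.

Information for the planner's restatement of the docking node (the crux must be restated anyway with the repaired
antecedent stmt-13733); a statement about the METHOD the crux encodes, not about its truth.
-/

namespace Summit.AtomisticToContinuum.HydrodynamicLimit.Theorems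

namespace ClampedEntropyClockNegative

/-- Shape of the typed docking node `KineticWindowLDUniform` restricted to the heat-flux truncation family
`(F_M)_M`: the admissible rate `β₀` is chosen AFTER `M`. [folklore] -/
def NodeShapeTyped (Λ : ℕ → ℝ → ℝ → ℕ → ℝ) : Prop :=
  ∀ M : ℕ, ∃ β₀ : ℝ, 0 < β₀ ∧ ∀ β : ℝ, 0 < β → β ≤ β₀ → ∀ ε : ℝ, 0 < ε →
    ∃ τ : ℝ, 0 < τ ∧ ∃ N₀ : ℕ, ∀ N : ℕ, N₀ ≤ N → Λ M β τ N ≤ ε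

/-- Shape of the repaired node (R1): for the bounded truncations, EVERY rate `β > 0` is admissible, the window
`τ` being chosen after `β`. [folklore] -/
def NodeShapeAllBeta (Λ : ℕ → ℝ → ℝ → ℕ → ℝ) : Prop :=
  ∀ M : ℕ, ∀ β : ℝ, 0 < β → ∀ ε : ℝ, 0 < ε →
    ∃ τ : ℝ, 0 < τ ∧ ∃ N₀ : ℕ, ∀ N : ℕ, N₀ ≤ N → Λ M β τ N ≤ ε

/-- Shape of `EnergyCurrentTails`: the cubic tail above level `M` is nonnegative and eventually below any `ε`,
with no rate. [folklore] -/
def TailShape (r : ℕ → ℝ) : Prop :=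
  (∀ M, 0 ≤ r M) ∧ ∀ ε : ℝ, 0 < ε → ∃ M : ℕ, r M ≤ ε

/-- What linear Gronwall certifies for the specific relative entropy at unit time from `h_0 = 0`: the factor
`exp(1/β)` times (entropy-inequality price of the truncated heat flux `Λ/β` + additive tail `r M`). [folklore] -/
noncomputable def gronwallBound (Λ : ℕ → ℝ → ℝ → ℕ → ℝ) (r : ℕ → ℝ) (M : ℕ) (β τ : ℝ) (N : ℕ) : ℝ :=
  Real.exp (1 / β) * (Λ M β τ N / β + r M)

/-- **Typed shapes certify nothing.** There are nonnegative inputs of the typed shapes — node valid exactly for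
`β ≤ β₀(M) = 1/(M+1)`, Gaussian-looking tail `r M = e^{-(M+1)/2}` — for which EVERY admissible bookkeeping choice
leaves the Gronwall certificate `≥ 1`: small `β` is killed by the factor `e^{1/β} ≥ e^{M+1}` against the tail,
large `β` by the price `Λ/β`. [folklore] -/
theorem exists_typedShapes_gronwallBound_ge_one :
    ∃ (Λ : ℕ → ℝ → ℝ → ℕ → ℝ) (r : ℕ → ℝ), (∀ M β τ N, 0 ≤ Λ M β τ N) ∧ NodeShapeTyped Λ ∧ TailShape r ∧
      ∀ (M : ℕ) (β : ℝ), 0 < β → ∀ (τ : ℝ) (N : ℕ), 1 ≤ gronwallBound Λ r M β τ N := by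
  classical
  refine ⟨fun M β _ _ => if β * ((M : ℝ) + 1) ≤ 1 then 0 else β, fun M => Real.exp (-(((M : ℝ) + 1) / 2)),
    ?_, ?_, ⟨fun M => (Real.exp_pos _).le, ?_⟩, ?_⟩
  · intro M β τ N
    simp only
    split_ifs with h
    · exact le_rfl
    · push Not at h
      by_contra hβ
      push Not at hβ
      have : β * ((M : ℝ) + 1) ≤ 0 := mul_nonpos_of_nonpos_of_nonneg hβ.le (by positivity)
      linarith
  · intro M
    refine ⟨1 / ((M : ℝ) + 1), by positivity, fun β hβ hβle ε hε => ⟨1, one_pos, 0, fun N _ => ?_⟩⟩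
    have hM : (0 : ℝ) < (M : ℝ) + 1 := by positivity
    have hle : β * ((M : ℝ) + 1) ≤ 1 := by
      calc β * ((M : ℝ) + 1) ≤ 1 / ((M : ℝ) + 1) * ((M : ℝ) + 1) :=
            mul_le_mul_of_nonneg_right hβle hM.le
        _ = 1 := by field_simp
    simp only [if_pos hle]
    exact hε.le
  · intro ε hε
    obtain ⟨M, hM⟩ := exists_nat_ge (2 / ε)
    refine ⟨M, ?_⟩
    have hM1 : (0 : ℝ) < (M : ℝ) + 1 := by positivity
    have hx : 1 + ((M : ℝ) + 1) / 2 ≤ Real.exp (((M : ℝ) + 1) / 2) := by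
      linarith [Real.add_one_le_exp (((M : ℝ) + 1) / 2)]
    show Real.exp (-(((M : ℝ) + 1) / 2)) ≤ ε
    rw [Real.exp_neg]
    calc (Real.exp (((M : ℝ) + 1) / 2))⁻¹ ≤ (1 + ((M : ℝ) + 1) / 2)⁻¹ := by
          gcongr
      _ ≤ (((M : ℝ) + 1) / 2)⁻¹ := by
          gcongr
          linarith
      _ = 2 / ((M : ℝ) + 1) := by rw [inv_div]
      _ ≤ ε := by
          rw [div_le_iff₀ hM1]
          have h2 : 2 / ε ≤ (M : ℝ) + 1 := by linarith
          rw [div_le_iff₀ hε] at h2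
          linarith [mul_comm ε ((M : ℝ) + 1)]
  · intro M β hβ τ N
    unfold gronwallBound
    simp only
    by_cases h : β * ((M : ℝ) + 1) ≤ 1
    · rw [if_pos h, zero_div, zero_add, ← Real.exp_add]
      apply Real.one_le_exp
      have hinv : (M : ℝ) + 1 ≤ 1 / β := by
        rw [le_div_iff₀ hβ, mul_comm]; exact h
      have hM0 : (0 : ℝ) ≤ (M : ℝ) + 1 := by positivity
      linarith
    · rw [if_neg h, div_self hβ.ne']
      have h1 : (1 : ℝ) ≤ Real.exp (1 / β) := Real.one_le_exp (by positivity)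
      have h2 : (1 : ℝ) ≤ 1 + Real.exp (-(((M : ℝ) + 1) / 2)) := by
        linarith [Real.exp_pos (-(((M : ℝ) + 1) / 2))]
      nlinarith

/-- **The `∀ β` shape closes the bookkeeping.** If the node holds for every rate (repair R1) and the tail has the
`EnergyCurrentTails` shape, the Gronwall certificate can be driven below any `η > 0`: take `β = 1`, then `M` for
the tail, then `τ, N₀` for the node. [folklore] -/
theorem allBeta_gronwallBound_small (Λ : ℕ → ℝ → ℝ → ℕ → ℝ) (r : ℕ → ℝ) (hΛ : NodeShapeAllBeta Λ)
    (hr : TailShape r) (η : ℝ) (hη : 0 < η) :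
    ∃ (M : ℕ) (β : ℝ), 0 < β ∧ ∃ τ : ℝ, 0 < τ ∧ ∃ N₀ : ℕ, ∀ N : ℕ, N₀ ≤ N →
      gronwallBound Λ r M β τ N ≤ η := by
  have he : 0 < Real.exp 1 := Real.exp_pos 1
  have hε : 0 < η / (2 * Real.exp 1) := by positivity
  obtain ⟨M, hM⟩ := hr.2 _ hε
  obtain ⟨τ, hτ, N₀, hN₀⟩ := hΛ M 1 one_pos _ hε
  refine ⟨M, 1, one_pos, τ, hτ, N₀, fun N hN => ?_⟩
  unfold gronwallBound
  rw [div_one, div_one]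
  calc Real.exp 1 * (Λ M 1 τ N + r M) ≤ Real.exp 1 * (η / (2 * Real.exp 1) + η / (2 * Real.exp 1)) := by
        gcongr
        exact hN₀ N hN
    _ = η := by field_simp; ring

end ClampedEntropyClockNegative

end Summit.AtomisticToContinuum.HydrodynamicLimit.Theorems
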